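import Mathlib
import HarnessLib
import Literature.Computability.AlgebraicComplexity.NilCoxeterTensor
import Summits.MatrixMultiplication.MatrixMultiplication.Theses.NilCoxeterShadow
import Summits.MatrixMultiplication.MatrixMultiplication.Theorems.NilCoxeterShadowAThesisStubFlatteningFloor

/-!
# `InductiveCosetGrowth → LinearBorderRigidity` — route glue `stmt-0958 ⟹ stmt-0959` (route `NilCoxeterShadow`)

Crux `stmt-MatrixMultiplication-0956` (`AThesis`), line `birth`/`registered`, lead cycle 2 (helper, lands
`--supports stmt-MatrixMultiplication-0956`). Writing `b n := bR(T_{NC_n}) = algBorderRank (nilCoxeterTensor ℂ n)`: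
the line's one open stub, the route item `InductiveCosetGrowth` (stmt-0958:
`∃ δ > 0, ∃ n₀, ∀ n ≥ n₀, (n+1)^(1+δ) · b n ≤ b (n+1)`), does not only imply the crux (glue
`aThesis_of_inductiveCosetGrowth`, landed) but also the route's rank-3 crux `LinearBorderRigidity` (stmt-0959:
`∃ c > 0, ∀ᶠ n, (2+c) · n! ≤ b n`): ONE inductive step on top of the flattening floor `m! ≤ b m`
(`stub_flatteningFloor`, landed) gives `b (m+1) ≥ (m+1)^(1+δ) · m! = (m+1)^δ · (m+1)! ≥ 3 · (m+1)!` as soon as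
`(m+1)^δ ≥ 3`. So within the route, stmt-0958 ⟹ stmt-0956 ∧ stmt-0959: the inductive engine is the single
load-bearing conjecture of ranks 0, 2, 3 (bookkeeping for the tenure planner; no claim about the converse).
-/

-- `Summit.<Summit>.<Problem>`: for the single-conjunct summit the duplicate component is mandated.
set_option linter.dupNamespace false

namespace Summit.MatrixMultiplication.MatrixMultiplication.Theorems.AThesis

open Literature.Computability.AlgebraicComplexity
open Summit.MatrixMultiplication.MatrixMultiplication.Theses.NilCoxeterShadow

/-- **Route glue `InductiveCosetGrowth → LinearBorderRigidity`** (stmt-MatrixMultiplication-0958 ⟹ 0959, both BY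
NAME), with `c = 1`: for `m ≥ n₀` with `(m+1)^δ ≥ 3`, the inductive step and the flattening floor give
`bR(T_{NC_{m+1}}) ≥ (m+1)^(1+δ) · bR(T_{NC_m}) ≥ (m+1)^(1+δ) · m! = (m+1)^δ · (m+1)! ≥ 3 · (m+1)!`.
[folklore] -/
theorem linearBorderRigidity_of_inductiveCosetGrowth : InductiveCosetGrowth → LinearBorderRigidity := by
  intro h
  have h' : ∃ δ : ℝ, 0 < δ ∧ ∃ n₀ : ℕ, ∀ n : ℕ, n₀ ≤ n →
      ((n : ℝ) + 1) ^ (1 + δ) * (algBorderRank (nilCoxeterTensor ℂ n) : ℝ) ≤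
        (algBorderRank (nilCoxeterTensor ℂ (n + 1)) : ℝ) := h
  obtain ⟨δ, hδ, n₀, hstep⟩ := h'
  -- `N ≥ 3^(1/δ)`, so that `N^δ ≥ 3`
  obtain ⟨N, hN⟩ := exists_nat_ge ((3 : ℝ) ^ (1 / δ))
  have key : ∃ c : ℝ, 0 < c ∧ ∀ᶠ n : ℕ in Filter.atTop,
      (2 + c) * (n.factorial : ℝ) ≤ (algBorderRank (nilCoxeterTensor ℂ n) : ℝ) := by
    refine ⟨1, one_pos, ?_⟩
    rw [Filter.eventually_atTop]
    refine ⟨max (n₀ + 1) N, fun n hn => ?_⟩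
    cases n with
    | zero => exact absurd (le_trans (le_max_left _ _) hn) (by omega)
    | succ m =>
      have hm : n₀ ≤ m := by
        have := le_trans (le_max_left _ _) hn
        omega
      have hmN : (N : ℝ) ≤ (m : ℝ) + 1 := by
        have := le_trans (le_max_right _ _) hn
        exact_mod_cast this
      have hs := hstep m hm
      have hfloor : ((m.factorial : ℕ) : ℝ) ≤ (algBorderRank (nilCoxeterTensor ℂ m) : ℝ) := by
        exact_mod_cast stub_flatteningFloor m
      have hm1 : (0 : ℝ) < (m : ℝ) + 1 := by positivity
      -- one inductive step above the floor
      have hb : ((m : ℝ) + 1) ^ (1 + δ) * ((m.factorial : ℕ) : ℝ) ≤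
          (algBorderRank (nilCoxeterTensor ℂ (m + 1)) : ℝ) :=
        le_trans (mul_le_mul_of_nonneg_left hfloor (Real.rpow_nonneg hm1.le _)) hs
      have hfac : (((m + 1).factorial : ℕ) : ℝ) = ((m : ℝ) + 1) * ((m.factorial : ℕ) : ℝ) := by
        rw [Nat.factorial_succ]
        push_cast
        ring
      have hpow : ((m : ℝ) + 1) ^ (1 + δ) = ((m : ℝ) + 1) * ((m : ℝ) + 1) ^ δ := by
        rw [Real.rpow_add hm1, Real.rpow_one]
      -- `(m+1)^δ ≥ N^δ ≥ (3^(1/δ))^δ = 3`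
      have h3 : (3 : ℝ) ≤ ((m : ℝ) + 1) ^ δ := by
        have h30 : (0 : ℝ) ≤ (3 : ℝ) ^ (1 / δ) := Real.rpow_nonneg (by norm_num) _
        have hle : (3 : ℝ) ^ (1 / δ) ≤ (m : ℝ) + 1 := hN.trans hmN
        have h1 : ((3 : ℝ) ^ (1 / δ)) ^ δ ≤ ((m : ℝ) + 1) ^ δ := Real.rpow_le_rpow h30 hle hδ.le
        have h2 : ((3 : ℝ) ^ (1 / δ)) ^ δ = 3 := by
          rw [← Real.rpow_mul (by norm_num : (0 : ℝ) ≤ 3), one_div, inv_mul_cancel₀ hδ.ne',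
            Real.rpow_one]
        rw [h2] at h1
        exact h1
      calc (2 + 1) * (((m + 1).factorial : ℕ) : ℝ)
          = 3 * (((m : ℝ) + 1) * ((m.factorial : ℕ) : ℝ)) := by rw [hfac]; norm_num
        _ ≤ ((m : ℝ) + 1) ^ δ * (((m : ℝ) + 1) * ((m.factorial : ℕ) : ℝ)) :=
            mul_le_mul_of_nonneg_right h3 (by positivity)
        _ = ((m : ℝ) + 1) ^ (1 + δ) * ((m.factorial : ℕ) : ℝ) := by rw [hpow]; ring
        _ ≤ (algBorderRank (nilCoxeterTensor ℂ (m + 1)) : ℝ) := hb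
  exact key

end Summit.MatrixMultiplication.MatrixMultiplication.Theorems.AThesis
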